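import Literature.Computability.QuantumComplexity.GRDataInit
import HarnessLib

/-!
# The concrete Grover–Rudolph block: the data-free list of ALL parameter wires and their classical sources

Topic `Literature/Computability/QuantumComplexity`, grouping namespace `GRData`; sequel of `GRDataInit.lean`
(`init m`: the parameter word `m.c` on the parameter wires `pw`, blank elsewhere; `eraseList m E`: the block images
of the parameter wires carrying a `1` — the wires the sampler's machine flips to uncompute the word).

`eraseList m E` depends on the WORD `m.c` (instance data), so a uniform circuit family cannot contain the `NOT` layer
on it. The data-free replacement flips every parameter wire CONDITIONALLY on a classical copy of its bit kept on a
source wire off the blocks (`Cryptography/RegevSamplerCnotLayer`, `RegevSamplerMachineU`). This file supplies the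
combinatorics of that replacement:

* `parList E` — the block images `E i (pw t)` of ALL parameter wires (depends on the sizes and positions only);
  `mem_parList_iff`, `nodup_parList` (pairwise disjoint blocks).
* `parSrc E src` — the source map: `E i (pw t) ↦ src t` (`parSrc_apply`), identity elsewhere; for sources off the
  blocks no source is a target (`parSrc_not_mem_parList`) and every source is off the blocks (`offBlocks_parSrc`).
* `mem_eraseList_iff_mem_parList` — **the erase list is the set of parameter wires whose source bit is set** in any
  label `z` carrying the word on the sources (`z (src t) = m.c t`): exactly the hypothesis `hmem` of
  `RegevSamplerMachineU.runOn_machineCircU_eq_runOn_machineCirc`.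

Everything is proved; no named fact is introduced. [cite: Regev2009, Lemma 3.14 (proof)] [cite: NielsenChuang2010, §3.2.5]

## References

* O. Regev, *On lattices, learning with errors, random linear codes, and cryptography*, J. ACM 56 (2009), art. 34:
  Lemma 3.14 (proof), Lemma 3.12 (proof) [Regev2009].
* M. A. Nielsen, I. L. Chuang, *Quantum Computation and Quantum Information*, CUP 2010, §3.2.5, §4.3 [NielsenChuang2010].
-/

noncomputable section

namespace Literature.Computability.QuantumComplexity

open Cryptography

namespace GRData

variable {ℓ np wlen kk : ℕ} {a : Fin ℓ → (Fin ℓ → Bool) → ℝ} (m : Mach ℓ np wlen kk a)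

section Par

variable {n W : ℕ} (E : Fin n → (Fin (B ℓ np wlen kk) ↪ Fin W))

/-- **All parameter wires of all blocks** (a data-free list: sizes and positions only). [cite: NielsenChuang2010, §4.3] -/
def parList : List (Fin W) := (List.finRange n).flatMap fun i => (List.finRange np).map fun t => E i (pw ℓ np wlen kk t)

/-- Membership in the list of parameter wires. [folklore] -/
theorem mem_parList_iff (w : Fin W) : w ∈ parList E ↔ ∃ i t, E i (pw ℓ np wlen kk t) = w := by
  simp only [parList, List.mem_flatMap, List.mem_finRange, true_and, List.mem_map]

variable {E} in
/-- Block images of parameter wires determine the block and the wire. [folklore] -/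
theorem pw_block_inj (hE : BlockDisjoint E) {i i' : Fin n} {t t' : Fin np}
    (h : E i (pw ℓ np wlen kk t) = E i' (pw ℓ np wlen kk t')) : i = i' ∧ t = t' := by
  have hi : i = i' := by
    by_contra hne
    exact Set.disjoint_left.1 (hE i i' hne) ⟨pw ℓ np wlen kk t, rfl⟩ ⟨pw ℓ np wlen kk t', h.symm⟩
  subst hi
  exact ⟨rfl, (pw ℓ np wlen kk).injective ((E i).injective h)⟩

variable {E} in
/-- **The parameter wires are distinct** when the blocks are pairwise disjoint. [folklore] -/
theorem nodup_parList (hE : BlockDisjoint E) : (parList E).Nodup := by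
  rw [parList, List.nodup_flatMap]
  refine ⟨fun i _ => List.Nodup.map (fun t t' h => (pw ℓ np wlen kk).injective ((E i).injective h)) (List.nodup_finRange np), ?_⟩
  refine List.Pairwise.imp_of_mem (R := (· ≠ ·)) ?_ (List.nodup_finRange n)
  intro i i' _ _ hne
  simp only [Function.onFun, List.disjoint_left, List.mem_map]
  rintro w ⟨t, -, rfl⟩ ⟨t', -, h⟩
  exact Set.disjoint_left.1 (hE i i' hne) ⟨pw ℓ np wlen kk t, rfl⟩ ⟨pw ℓ np wlen kk t', h⟩

open Classical in
/-- **The source map**: the parameter wire `E i (pw t)` is controlled by the source `src t`; every other wire is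
its own source (irrelevant). [cite: NielsenChuang2010, §4.3] -/
def parSrc (src : Fin np → Fin W) (w : Fin W) : Fin W :=
  if h : ∃ p : Fin n × Fin np, E p.1 (pw ℓ np wlen kk p.2) = w then src h.choose.2 else w

variable {E} in
/-- The source of a parameter wire. [folklore] -/
theorem parSrc_apply (hE : BlockDisjoint E) (src : Fin np → Fin W) (i : Fin n) (t : Fin np) :
    parSrc E src (E i (pw ℓ np wlen kk t)) = src t := by
  classical
  have h : ∃ p : Fin n × Fin np, E p.1 (pw ℓ np wlen kk p.2) = E i (pw ℓ np wlen kk t) := ⟨(i, t), rfl⟩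
  unfold parSrc
  rw [dif_pos h, (pw_block_inj hE h.choose_spec).2]

variable {E} in
/-- **No source is a target** when the sources are off the blocks. [folklore] -/
theorem parSrc_not_mem_parList (hE : BlockDisjoint E) (src : Fin np → Fin W) (hsrc : ∀ t, OffBlocks E (src t)) :
    ∀ w ∈ parList E, parSrc E src w ∉ parList E := by
  intro w hw hmem
  obtain ⟨i, t, rfl⟩ := (mem_parList_iff E w).1 hw
  rw [parSrc_apply hE] at hmem
  obtain ⟨i', t', h⟩ := (mem_parList_iff E _).1 hmem
  exact hsrc t i' ⟨pw ℓ np wlen kk t', h⟩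

variable {E} in
/-- The sources of the parameter wires are off the blocks. [folklore] -/
theorem offBlocks_parSrc (hE : BlockDisjoint E) (src : Fin np → Fin W) (hsrc : ∀ t, OffBlocks E (src t)) :
    ∀ w ∈ parList E, OffBlocks E (parSrc E src w) := by
  intro w hw
  obtain ⟨i, t, rfl⟩ := (mem_parList_iff E w).1 hw
  rw [parSrc_apply hE]
  exact hsrc t

variable {E} in
/-- **The erase list is the set of parameter wires whose source bit is set**, for every label carrying the parameter
word on the sources. [cite: Regev2009, Lemma 3.14 (proof)] [cite: NielsenChuang2010, §3.2.5] -/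
theorem mem_eraseList_iff_mem_parList (hE : BlockDisjoint E) (src : Fin np → Fin W) (z : QReg W)
    (hz : ∀ t, z (src t) = m.c t) (w : Fin W) : w ∈ eraseList m E ↔ w ∈ parList E ∧ z (parSrc E src w) = true := by
  rw [mem_eraseList_iff', mem_parList_iff]
  constructor
  · rintro ⟨i, t, ht, rfl⟩
    exact ⟨⟨i, t, rfl⟩, by rw [parSrc_apply hE, hz, ht]⟩
  · rintro ⟨⟨i, t, rfl⟩, h⟩
    exact ⟨i, t, by rw [← hz, ← parSrc_apply hE src i t]; exact h, rfl⟩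

end Par

end GRData

end Literature.Computability.QuantumComplexity

end
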